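import Summits.KontsevichZagierPeriods.KontsevichZagierPeriods.Theorems.SymplecticScissorsRealOnePeriodRelationsMultiEllLayer
import Summits.KontsevichZagierPeriods.KontsevichZagierPeriods.Theorems.SymplecticScissorsRealOnePeriodRelationsStubFamAlternatives
import Literature.NumberTheory.Transcendental.ManyCurveSemistabilityTheorem

/-!
# `RealOnePeriodRelations` (stmt-KontsevichZagierPeriods-10042), line `nash-retraction-thin-strip`, reshape 8:
# the MULTI-CURVE OPEN-PATH layer of the crux from Baker–Wüstholz's Semistability Theorem for the
# FAMILY standard models at ALL algebraic points

The c6 layer `MultiEllLayer.realOnePeriodRelations_multiIsoLayer_of_hyperplaneTheorem` is conditional on an inline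
hypothesis — the hyperplane theorem for the quotients of `G = 𝔾ₐ × 𝔾ₘ^ι × ∏_b E_{cls b}♮` at general algebraic points —
which nothing in the tree supplies for ≥ 2 isogeny classes.  This file replaces it by ONE published statement,
Baker–Wüstholz's Semistability Theorem (Thm. 6.15) for the family standard models `M = 𝔾ₘ^β × P` at all algebraic
points (`semistabilityTheorem_famStd`, the family twin of the tree's discharged one-lattice fact `semistabilityTheorem_std`):

* the named fact `semistabilityTheorem_famStd` (Literature, `ManyCurveSemistabilityTheorem.lean`);
* `hstdH_of_famStd` — its hyperplane form (a hyperplane without non-zero algebraic Lie subalgebras is proper and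
  semistable);
* `manyIsoPaths_of_famStd` — Huber–Wüstholz 13.3 (2) for arbitrary paths on a finite family of pairwise non-isogenous
  non-CM curves, their isogenous models, the punctured lines, `𝔾ₘ`, `𝔸¹` (the landed `stub_famAlternatives`,
  `stub_ellNormalForm`, `stub_manyPathsCore`, `manyIsoPaths_of_core`);
* **`realOnePeriodRelations_multiIsoLayer_of_famStd`** — THE LAYER: every `ℤ`-relation with value `0` among rational
  representations, first/second-kind real abelian integrals with algebraic end points and convergent first-kind tails on
  ANY finite family of real non-CM Weierstrass curves (lattices isogenous into pairwise non-isogenous `M_i`) lies in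
  `M₁ = closure (1a ∪ 1b ∪ 2 ∪ Green)`, GIVEN `semistabilityTheorem_famStd`.

The reduction of the named fact to the family Baker engine at reduced algebraic points (dichotomy from an engine
output, stable case, induction over borderline quotients and subgroups) is landed separately
(`stub_famDichotomyOfEngine`, `stub_famSubAlg`, …).

References: A. Baker, G. Wüstholz, *Logarithmic Forms and Diophantine Geometry* (CUP 2007), Thm. 6.15, §6.7, §6.8;
A. Huber, G. Wüstholz, *Transcendence and Linear Relations of 1-Periods* (CUP 2022), Thm. 13.3 (2), §13.2, Ch. 15,
Thm. 15.3, Thm. 6.2; M. Kontsevich, D. Zagier, *Periods* (2001), §1.2.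
-/

noncomputable section

open scoped BigOperators Polynomial
open Set MeasureTheory MvPolynomial Complex Module Submodule
open Literature.NumberTheory.Transcendental Literature.NumberTheory.Transcendental.CurvePeriods
open Summit.KontsevichZagierPeriods.SymplecticScissors.RealOnePeriodRelationsNegative (M₁ H₁)

namespace Summit.KontsevichZagierPeriods.SymplecticScissors.RealOnePeriodRelations

namespace MultiEllLayer

/-! The named fact `Literature.NumberTheory.Transcendental.semistabilityTheorem_famStd` (Baker–Wüstholz Thm. 6.15 for the family
standard models at all algebraic points) is the Literature file `ManyCurveSemistabilityTheorem.lean`. -/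

/-- The hyperplane form of `semistabilityTheorem_famStd` at all algebraic points (a `ℚ̄`-rational hyperplane without non-zero
algebraic Lie subalgebras is proper and semistable: `GaGmE.Std.ne_top_of_hyperplane`, `GaGmEFam.Std.semistable_of_hyperplane`).
[cite: BakerWustholz2007, §6.7, Thm. 6.15] -/
theorem hstdH_of_famStd (h : semistabilityTheorem_famStd) :
    ∀ (J : Type) [Fintype J] [DecidableEq J] (L : J → PeriodPair),
      (∀ i, IsAlgebraic ℚ (L i).g₂ ∧ IsAlgebraic ℚ (L i).g₃) →
      (∀ i j, i ≠ j → ¬ (L i).IsIsogenousTo (L j)) →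
      ∀ (β γ δ : Type) [Fintype β] [Fintype γ] [Fintype δ] (cls : γ → J),
        (∀ b b', cls b = cls b' → (L (cls b)).HasCM → b = b') →
        ∀ (κM : δ → γ → GaGmE.Kbar) (W : Submodule ℂ (β ⊕ (γ ⊕ δ) → ℂ)),
        LiePresentation.IsKRational GaGmE.Kbar W → Module.finrank ℂ W + 1 = Fintype.card (β ⊕ (γ ⊕ δ)) →
        (∀ 𝔨 ∈ GaGmEFam.Std.algLie cls κM, 𝔨 ≤ W → 𝔨 = ⊥) →
        ∀ w ∈ W, w ∈ GaGmEFam.Std.Alg L cls κM → w ∈ GaGmEFam.Std.ker L cls κM :=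
  fun J _ _ L hL hiso β γ δ _ _ _ cls hcm1 κM W hWrat hWdim hno w hwW hwAlg =>
    h J L hL hiso β γ δ cls hcm1 κM W hWrat (GaGmE.Std.ne_top_of_hyperplane hWdim)
      (GaGmEFam.Std.semistable_of_hyperplane cls κM hWdim hno) w hwW hwAlg

/-- **Huber–Wüstholz 13.3 (2) for ARBITRARY paths on a finite family of pairwise non-isogenous non-CM curves, their isogenous
models, the punctured lines, `𝔾ₘ` and `𝔸¹` — from `semistabilityTheorem_famStd`.**  Composition of `stub_famAlternatives`
(through `hstdH_of_famStd`), the landed `stub_ellNormalForm`, `stub_manyPathsCore` and `manyIsoPaths_of_core`.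
[cite: HuberWustholz2022, Thm 13.3 (2), §13.2, Ch. 15] [cite: BakerWustholz2007, Thm 6.15] -/
theorem manyIsoPaths_of_famStd (hX : semistabilityTheorem_famStd) {J : Type} [Fintype J] [DecidableEq J] (M : J → PeriodPair)
    (hM : ∀ i, IsAlgebraic ℚ (M i).g₂ ∧ IsAlgebraic ℚ (M i).g₃)
    (hiso : ∀ i j, i ≠ j → ¬ (M i).IsIsogenousTo (M j)) (hCM : ∀ i, ¬ (M i).HasCM)
    (c : PeriodSymbol →₀ ℂ) (hc : ∀ s, IsAlgebraic ℚ (c s))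
    (hsupp : ∀ s ∈ c.support,
      (∃ (i : J) (L : PeriodPair) (α : ℂ), IsAlgebraic ℚ L.g₂ ∧ IsAlgebraic ℚ L.g₃ ∧ α ≠ 0 ∧ IsAlgebraic ℚ α ∧
          (∀ l ∈ L.lattice, α * l ∈ (M i).lattice) ∧ s.Z = Ell.curve L) ∨
      (∃ (r : ℕ) (a : Fin r → ℂ), Function.Injective a ∧ (∀ i, IsAlgebraic ℚ (a i)) ∧
          s.Z = (⟨2, 1, ![X 1 * ∏ i, (X 0 - C (a i)) - 1]⟩ : CurveData)) ∨
      (∃ i, s.Z = Ell.curve (M i)) ∨ s.Z = (⟨2, 1, ![X 0 * X 1 - 1]⟩ : CurveData) ∨ s.Z = CurveData.affineLine)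
    (h0 : evalCombination c = 0) :
    ∃ (k : ℕ) (ρ : Fin k → (PeriodSymbol →₀ ℂ)) (a : Fin k → ℂ),
      (∀ l, IsElementaryRelation (ρ l)) ∧ (∀ l, IsAlgebraic ℚ (a l)) ∧ c = ∑ l, a l • ρ l :=
  manyIsoPaths_of_core M hM
    (fun c' hc' hsupp' h0' => stub_manyPathsCore M hM
      (fun j T hT => stub_ellNormalForm (M j) (hM j).1 (hM j).2 T hT)
      (fun ι B _ _ cls x y z t hx hy hzt hdep =>
        stub_famAlternatives (hstdH_of_famStd hX) M hM hiso ι B cls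
          (fun b _ _ hcm => absurd hcm (hCM (cls b))) x y z t hx hy hzt hdep)
      c' hc' hsupp' h0')
    c hc hsupp h0

/-- **THE MULTI-CURVE OPEN-PATH LAYER OF THE CRUX, from Baker–Wüstholz's Semistability Theorem for the family standard models at
all algebraic points.**  Let `M_i` (`i ∈ J`, finite) be pairwise non-isogenous lattices with algebraic invariants and without
complex multiplication, and let `E_j : y² = x³ + A_j x + B_j` (`j ∈ ι`, `A_j, B_j` real algebraic) be real Weierstrass curves whose
lattices `L_j` map by algebraic isogenies `z ↦ α_j z` into `M_{κ j}`.  GIVEN `semistabilityTheorem_famStd`, every `ℤ`-combination with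
vanishing value of rational representations, first/second-kind real abelian integrals on the `E_j` (integrand
`P₁ + P₂√f_j + P₃/√f_j` on an interval of positivity of `f_j` with algebraic end points) and convergent tails `c₀/√f_j` on
`(M′, ∞)` lies in `M₁ = closure (1a ∪ 1b ∪ 2 ∪ Green)`.  Proof: `SectorGlue.realOnePeriodRelations_of_sector` with
`IsoLayer.isoCells`, `IsoLayer.isoArcs` and `manyIsoPaths_of_famStd`.
[cite: HuberWustholz2022, Thm 13.3 (2), §13.2, Ch. 15] [cite: BakerWustholz2007, Thm 6.15] [cite: KontsevichZagier2001, §1.2] -/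
theorem realOnePeriodRelations_multiIsoLayer_of_famStd : Literature.NumberTheory.Transcendental.semistabilityTheorem_famStd → ∀ {ι J : Type} [Fintype J] [DecidableEq J]
    (A B : ι → ℝ), (∀ j, IsAlgebraic ℚ (A j)) → (∀ j, IsAlgebraic ℚ (B j)) →
    ∀ (M : J → PeriodPair), (∀ i, IsAlgebraic ℚ (M i).g₂ ∧ IsAlgebraic ℚ (M i).g₃) →
    (∀ i j, i ≠ j → ¬ (M i).IsIsogenousTo (M j)) → (∀ i, ¬ (M i).HasCM) →
    ∀ (L : ι → PeriodPair) (κ : ι → J) (α : ι → ℂ), (∀ j, (L j).g₂ = -4 * (A j : ℂ)) → (∀ j, (L j).g₃ = -4 * (B j : ℂ)) →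
    (∀ j, α j ≠ 0) → (∀ j, IsAlgebraic ℚ (α j)) → (∀ j, ∀ l ∈ (L j).lattice, α j * l ∈ (M (κ j)).lattice) →
    ∀ c : KZ.FormalRep, c ∈ AddSubgroup.closure ((fun r : KZ.IntegralRep 1 => KZ.of r) ''
      {r | r.IsRational ∨
        (∃ j, ∃ a b : ℝ, IsAlgebraic ℚ a ∧ IsAlgebraic ℚ b ∧ a < b ∧ r.domain = {z | z 0 ∈ Set.Ioo a b} ∧
          (∀ x ∈ Set.Ioo a b, 0 < x ^ 3 + A j * x + B j) ∧
          ∃ P₁ P₂ P₃ : Polynomial (algebraicClosure ℚ ℝ), ∀ x ∈ Set.Ioo a b,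
            r.integrand (fun _ => x) = Polynomial.aeval x P₁ + Polynomial.aeval x P₂ * Real.sqrt (x ^ 3 + A j * x + B j) +
              Polynomial.aeval x P₃ / Real.sqrt (x ^ 3 + A j * x + B j)) ∨
        (∃ j, ∃ e M c₀ : ℝ, IsAlgebraic ℚ e ∧ IsAlgebraic ℚ M ∧ IsAlgebraic ℚ c₀ ∧ e ^ 3 + A j * e + B j = 0 ∧
          0 < 3 * e ^ 2 + A j ∧ e < M ∧ (∀ x : ℝ, e < x → 0 < x ^ 3 + A j * x + B j) ∧ r.domain = {z | M < z 0} ∧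
          ∀ z ∈ r.domain, r.integrand z = c₀ / Real.sqrt ((z 0) ^ 3 + A j * (z 0) + B j))}) →
    KZ.eval c = 0 →
    c ∈ AddSubgroup.closure (KZ.domainAddRel ∪ KZ.integrandAddRel ∪ KZ.changeOfVariablesRel ∪
      {g : KZ.FormalRep | ∃ (Δ : Set (Fin 2 → ℝ)) (A B S : (Fin 2 → ℝ) → ℝ) (r₀₁ r₁₂ r₀₂ : KZ.IntegralRep 1),
        Δ = {p | 0 ≤ p 0 ∧ 0 ≤ p 1 ∧ p 0 + p 1 ≤ 1} ∧ IsSemialgebraicFunOn ℚ Δ A ∧ IsSemialgebraicFunOn ℚ Δ B ∧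
        ContinuousOn A Δ ∧ ContinuousOn B Δ ∧
        (∀ p : Fin 2 → ℝ, 0 < p 0 → 0 < p 1 → p 0 + p 1 < 1 →
          HasFDerivAt S (A p • ContinuousLinearMap.proj (R := ℝ) (φ := fun _ : Fin 2 => ℝ) 0 +
            B p • ContinuousLinearMap.proj (R := ℝ) (φ := fun _ : Fin 2 => ℝ) 1) p) ∧
        r₀₁.domain = {z | z 0 ∈ Set.Ioo 0 1} ∧ r₁₂.domain = {z | z 0 ∈ Set.Ioo 0 1} ∧
        r₀₂.domain = {z | z 0 ∈ Set.Ioo 0 1} ∧ (∀ z ∈ r₀₁.domain, r₀₁.integrand z = A ![z 0, 0]) ∧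
        (∀ z ∈ r₁₂.domain, r₁₂.integrand z = B ![1 - z 0, z 0] - A ![1 - z 0, z 0]) ∧
        (∀ z ∈ r₀₂.domain, r₀₂.integrand z = B ![0, z 0]) ∧ g = KZ.of r₀₁ + KZ.of r₁₂ - KZ.of r₀₂}) := by
  intro hX ι J _ _ A B hA hB M hM hiso hCM L κ α hL₂ hL₃ hα hαalg hαM c hc heval
  change c ∈ M₁
  have hD : ∀ j, 4 * A j ^ 3 + 27 * B j ^ 2 ≠ 0 := by
    intro j h
    apply (L j).discr_ne_zero
    rw [hL₂ j, hL₃ j]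
    have h' : ((4 * A j ^ 3 + 27 * B j ^ 2 : ℝ) : ℂ) = 0 := by rw [h]; simp
    push_cast at h'
    linear_combination (-16 : ℂ) * h'
  have hg₂ : ∀ j, IsAlgebraic ℚ (L j).g₂ := fun j => by
    rw [hL₂ j]; exact ((isAlgebraic_int 4).neg).mul (hA j).algebraMap
  have hg₃ : ∀ j, IsAlgebraic ℚ (L j).g₃ := fun j => by
    rw [hL₃ j]; exact ((isAlgebraic_int 4).neg).mul (hB j).algebraMap
  refine SectorGlue.realOnePeriodRelations_of_sector _ _ _ (fun C hCalg hCsupp hC0 => ?_)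
    (IsoLayer.isoCells A B hA hB) (IsoLayer.isoArcs A B hA hB hD) c hc heval
  refine manyIsoPaths_of_famStd hX M hM hiso hCM C hCalg (fun s hs => ?_) hC0
  rcases hCsupp s hs with hP | ⟨j, hj⟩
  · exact Or.inr (Or.inl hP)
  · exact Or.inl ⟨κ j, L j, α j, hg₂ j, hg₃ j, hα j, hαalg j, hαM j,
      hj.trans (Ell.curve_eq_weierCurve (hL₂ j) (hL₃ j)).symm⟩


end MultiEllLayer

end Summit.KontsevichZagierPeriods.SymplecticScissors.RealOnePeriodRelations

end
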